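import Literature.Analysis.FluidPDE.NSLerayBlowupRateLpProofs
import Literature.Analysis.FluidPDE.NSLerayStrongLocalExistence
import HarnessLib

/-!
# Leray's `Lʳ` blow-up rate (**ns.S28** `leray_blowup_rate`): the dependency record

Leaf file of the decomposition of the named fact
`Literature.Analysis.FluidPDE.leray_blowup_rate` (`NSLerayHopf.lean`; Leray 1934, §22;
Ożański–Pooley 2018, Cor. 6.25). With

* the proved glue `leray_blowup_rate_of_top_of_supnorm :
  leray_blowup_rate_top → leray_supnorm_le_of_Lp → leray_blowup_rate` (`NSLerayBlowupRateLp.lean`,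
  Ożański–Pooley's proof of Cor. 6.25 through Cor. 6.24 (iii)),
* the discharge `leray_supnorm_le_of_Lp_holds` (`NSLerayBlowupRateLpProofs.lean`; Lemma 6.23 (iii)
  via the representation formula (6.55), the integral inequality (6.65) and the comparison
  principle Lemma 6.5 — `NSLerayOseenRepresentation.lean`, `LerayVolterraComparison.lean`),
* the proved glue `leray_blowup_rate_top_of_strong_local_existence` (`NSLerayBlowupRate.lean`) and
  the reductions of Leray's local existence theorem `leray_strong_local_existence` to the smoothing
  of bounded mild solutions (`NSLerayStrongLocalExistence.lean`),

the `Lʳ` rate now rests on **one** hypothesis, in any of the equivalent currencies recorded below: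
`leray_blowup_rate_top` (the `r = ∞` rate, **ns.S28**), `leray_strong_local_existence` (Leray
1934, §19; Ożański–Pooley Thm. 6.22), `classical_of_bounded_mild_L3` (Giga 1986, Thm. 4;
Lemarié-Rieusset 2016, Thm. 9.12), `knss2009_local_smoothing ℝ³` (Koch–Nadirashvili–Seregin–Šverák
2009, Prop. 4.1) or `lemarieRieusset2016_local_analyticity` (Lemarié-Rieusset 2016, Thm. 9.12).
The unconditional `leray_blowup_rate_holds` is the one-line application of `leray_blowup_rate_of_top`
to `leray_blowup_rate_top_holds` once the latter lands; nothing is asserted here.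

## References

* J. Leray, *Sur le mouvement d'un liquide visqueux emplissant l'espace*, Acta Math. 63 (1934),
  §19 (3.8)–(3.9), §21 (3.5), (3.14)–(3.16), §22 (pp. 222–228). [Leray1934]
* W. S. Ożański, B. C. Pooley, in: Partial Differential Equations in Fluid Mechanics, LMS Lecture
  Note Ser. 452, CUP 2018, Thm. 6.22, Lemma 6.23, Cor. 6.24, Cor. 6.25 (pp. 139–146).
  [OzanskiPooley2018]
* G. Koch, N. Nadirashvili, G. Seregin, V. Šverák, Acta Math. 203 (2009) = arXiv:0709.3599,
  Prop. 4.1. [KochNadirashviliSereginSverak2009]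
* P. G. Lemarié-Rieusset, *The Navier–Stokes problem in the 21st century*, CRC Press 2016,
  Thm. 9.12. [LemarieRieusset2016]
* Y. Giga, J. Differential Equations 62 (1986), Thm. 4. [Giga1986]
-/

noncomputable section

namespace Literature.Analysis.FluidPDE

/-- **Leray's `Lʳ` blow-up rate from the `L^∞` rate** (`leray_blowup_rate_top → leray_blowup_rate`):
the glue `leray_blowup_rate_of_top_of_supnorm` (Ożański–Pooley 2018, Cor. 6.25 via Cor. 6.24 (iii);
Leray 1934, §22) fed with the discharge `leray_supnorm_le_of_Lp_holds` (Lemma 6.23 (iii)).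
[cite: OzanskiPooley2018, Cor. 6.25 with Cor. 6.24 (iii), Lemma 6.23 (iii)] [cite: Leray1934, §22 pp. 227–228] -/
theorem leray_blowup_rate_of_top (h : leray_blowup_rate_top) : leray_blowup_rate :=
  leray_blowup_rate_of_top_of_supnorm h leray_supnorm_le_of_Lp_holds

/-- **Leray's `Lʳ` blow-up rate from Leray's local existence theorem** for `L² ∩ L^∞` data with the
lifespan (3.8) (`leray_strong_local_existence`; Leray 1934, §19; Ożański–Pooley 2018, Thm. 6.22):
through `leray_blowup_rate_top_of_strong_local_existence`. [cite: Leray1934, §19 (3.8)–(3.9), §22] [cite: OzanskiPooley2018, Thm. 6.22, Cor. 6.25] -/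
theorem leray_blowup_rate_of_strong_local_existence (h : leray_strong_local_existence) :
    leray_blowup_rate :=
  leray_blowup_rate_of_top (leray_blowup_rate_top_of_strong_local_existence h)

/-- **Leray's `Lʳ` blow-up rate from the smoothing of bounded mild `L³` solutions**
(`classical_of_bounded_mild_L3`; Giga 1986, Thm. 4; Lemarié-Rieusset 2016, Thm. 9.12): through
`leray_blowup_rate_top_of_classical_of_bounded_mild_L3`. [cite: Giga1986, Thm. 4] [cite: OzanskiPooley2018, Cor. 6.25] -/
theorem leray_blowup_rate_of_classical_of_bounded_mild_L3 (h : classical_of_bounded_mild_L3) :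
    leray_blowup_rate :=
  leray_blowup_rate_of_top (leray_blowup_rate_top_of_classical_of_bounded_mild_L3 h)

/-- **Leray's `Lʳ` blow-up rate from the KNSS local theory (L)** (`knss2009_local_smoothing ℝ³`;
Koch–Nadirashvili–Seregin–Šverák 2009, Prop. 4.1): through
`leray_strong_local_existence_of_knss2009_local_smoothing`. [cite: KochNadirashviliSereginSverak2009, Prop. 4.1 (arXiv:0709.3599 p. 8)] [cite: OzanskiPooley2018, Cor. 6.25] -/
theorem leray_blowup_rate_of_knss2009_local_smoothing
    (h : knss2009_local_smoothing (EuclideanSpace ℝ (Fin 3))) : leray_blowup_rate :=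
  leray_blowup_rate_of_strong_local_existence (leray_strong_local_existence_of_knss2009_local_smoothing h)

/-- **Leray's `Lʳ` blow-up rate from the local analyticity of Oseen's scheme**
(`lemarieRieusset2016_local_analyticity`; Lemarié-Rieusset 2016, Thm. 9.12): through
`leray_strong_local_existence_of_local_analyticity`. [cite: LemarieRieusset2016, Thm. 9.12 (PDF p. 260)] [cite: OzanskiPooley2018, Cor. 6.25] -/
theorem leray_blowup_rate_of_local_analyticity (h : lemarieRieusset2016_local_analyticity) :
    leray_blowup_rate :=
  leray_blowup_rate_of_strong_local_existence (leray_strong_local_existence_of_local_analyticity h)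

end Literature.Analysis.FluidPDE

end
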